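import Summits.BirchSwinnertonDyer.BirchSwinnertonDyer.Theorems.ManinLocalTwoThreeAtkinLehnerShimuraSignLaw
import Literature.NumberTheory.EllipticCurves.PeriodLatticeGamma1QuotientProofs
import Literature.NumberTheory.EllipticCurves.ModularSymbolsLattice
import HarnessLib

/-!
# The Shimura quotient modulo period-zero residues (imc g41, THEOREM 53.A)

Landed by LEAD p1 g25 from `HOME/imc/g41/Sketch53.lean` (sha16 990e816561e7628d, T-imc-53): «the Shimura quotient `Λ₀(f)/Λ₁(f)` is `(ℤ/N)ˣ` modulo the
period-zero residues» (fact-free, sorry-free).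

For `f ∈ S₂(Γ₀(N))`, Manin's homomorphism `γ ↦ {∞, γ∞}_f` (`cuspSymbol f`) maps `Γ₀(N)` onto
`Λ₀(f) = periodLattice f` and `Γ₁(N)` onto `Λ₁(f) = periodLatticeGamma1 f`, and the class of
`{∞, γ∞}_f mod Λ₁(f)` depends only on `d_γ mod N` (tree: `cuspSymbol_sub_mem_periodLatticeGamma1_of_apply_eq`),
whence Stevens' surjection `θ : (ℤ/N)ˣ ↠ Λ₀(f)/Λ₁(f)`.  THEOREM 53.A computes its kernel:

  `{∞, γ∞}_f ∈ Λ₁(f)  ↔  ∃ δ ∈ Γ₀(N), d_δ ≡ d_γ (mod N) ∧ {∞, δ∞}_f = 0`,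

i.e. `ker θ = {d_δ : δ ∈ Γ₀(N), {∞, δ∞}_f = 0}` (the PERIOD-ZERO RESIDUES), and hence
`Λ₁(f) = Λ₀(f)` (the `Γ₁`-periods fill the `Γ₀`-lattice; for the newform of a curve: the
Stevens `X₁(N)`-optimal curve equals the `X₀(N)`-optimal one up to the scaling in the tree's
dictionary) iff EVERY unit residue mod `N` is the `d`-entry of a matrix in `Γ₀(N)` with zero period.
This is the statement behind ENGINE S (imc/g41/shimura53.py): `Λ₀/Λ₁ ≅ G_N / Θ(H₁(X₀(N),ℤ) ∩ V_f^⊥)`.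
-/

open scoped MatrixGroups ModularForm
open CongruenceSubgroup
open Literature.NumberTheory.EllipticCurves Literature.NumberTheory.EllipticCurves.ModularForms

set_option autoImplicit false

set_option linter.dupNamespace false

namespace Summit.BirchSwinnertonDyer.BirchSwinnertonDyer.Theorems.ManinLocalTwoThree.ShimuraLambdaOneImage

variable {N : ℕ} [NeZero N] (f : CuspForm (Gamma0 N) 2)

/-- `{∞, γ⁻¹∞}_f = −{∞, γ∞}_f` (Manin's homomorphism). -/
theorem cuspSymbol_inv_eq_neg (γ : Gamma0 N) : cuspSymbol f γ⁻¹ = -cuspSymbol f γ := by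
  have h := cuspSymbol_mul_holds f γ⁻¹ γ
  rw [inv_mul_cancel, cuspSymbol_one] at h
  linear_combination -h

/-- **53.A (i)** `Λ₁(f)` is the IMAGE of `Γ₁(N)` under Manin's homomorphism (not merely the subgroup it
generates): `x ∈ Λ₁(f) ↔ x = {∞, γ∞}_f` for some `γ ∈ Γ₁(N)`. -/
theorem mem_periodLatticeGamma1_iff_exists (x : ℂ) :
    x ∈ periodLatticeGamma1 f ↔
      ∃ γ : Gamma1 N, cuspSymbol f ⟨(γ : SL(2, ℤ)), Gamma1_in_Gamma0 N γ.2⟩ = x := by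
  constructor
  · intro hx
    refine AddSubgroup.closure_induction (fun y hy ↦ ?_) ?_ (fun y z _ _ hy hz ↦ ?_) (fun y _ hy ↦ ?_) hx
    · obtain ⟨γ, rfl⟩ := hy
      exact ⟨γ, rfl⟩
    · refine ⟨1, ?_⟩
      have h1 : (⟨((1 : Gamma1 N) : SL(2, ℤ)), Gamma1_in_Gamma0 N (1 : Gamma1 N).2⟩ : Gamma0 N) = 1 :=
        Subtype.ext rfl
      rw [h1]
      exact cuspSymbol_one f
    · obtain ⟨γ, rfl⟩ := hy
      obtain ⟨δ, rfl⟩ := hz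
      refine ⟨γ * δ, ?_⟩
      exact cuspSymbol_mul_holds f ⟨(γ : SL(2, ℤ)), Gamma1_in_Gamma0 N γ.2⟩ ⟨(δ : SL(2, ℤ)), Gamma1_in_Gamma0 N δ.2⟩
    · obtain ⟨γ, rfl⟩ := hy
      refine ⟨γ⁻¹, ?_⟩
      exact cuspSymbol_inv_eq_neg f ⟨(γ : SL(2, ℤ)), Gamma1_in_Gamma0 N γ.2⟩
  · rintro ⟨γ, rfl⟩
    exact cuspSymbol_mem_periodLatticeGamma1 f γ

/-- **53.A (ii) — THE KERNEL OF STEVENS' `θ`.**  `{∞, γ∞}_f ∈ Λ₁(f)` iff some `δ ∈ Γ₀(N)` with the same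
lower-right entry mod `N` has ZERO period.  (`→`: `δ = γ·γ₁⁻¹` for a `γ₁ ∈ Γ₁(N)` with the same period;
`←`: `{∞, γ∞}_f − {∞, δ∞}_f ∈ Λ₁(f)` by `cuspSymbol_sub_mem_periodLatticeGamma1_of_apply_eq`.) -/
theorem cuspSymbol_mem_periodLatticeGamma1_iff_exists_zero_period (γ : Gamma0 N) :
    cuspSymbol f γ ∈ periodLatticeGamma1 f ↔
      ∃ δ : Gamma0 N, (((δ : SL(2, ℤ)) 1 1 : ℤ) : ZMod N) = (((γ : SL(2, ℤ)) 1 1 : ℤ) : ZMod N) ∧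
        cuspSymbol f δ = 0 := by
  constructor
  · intro h
    obtain ⟨γ₁, hγ₁⟩ := (mem_periodLatticeGamma1_iff_exists f _).mp h
    set g₁ : Gamma0 N := ⟨(γ₁ : SL(2, ℤ)), Gamma1_in_Gamma0 N γ₁.2⟩ with hg₁
    have hker : Gamma0Map N g₁ = 1 := ((Gamma1_mem N (γ₁ : SL(2, ℤ))).mp γ₁.2).2.1
    refine ⟨γ * g₁⁻¹, ?_, ?_⟩
    · have hmap : Gamma0Map N (γ * g₁⁻¹) = Gamma0Map N γ := by
        have hm := map_mul (Gamma0Map N) (γ * g₁⁻¹) g₁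
        rw [inv_mul_cancel_right, hker, mul_one] at hm
        exact hm.symm
      exact hmap
    · rw [cuspSymbol_mul_holds f γ g₁⁻¹, cuspSymbol_inv_eq_neg, hγ₁, add_neg_cancel]
  · rintro ⟨δ, hd, h0⟩
    have h := cuspSymbol_sub_mem_periodLatticeGamma1_of_apply_eq f δ γ hd
    rwa [h0, sub_zero] at h

/-- **53.A (iii)** `Λ₁(f) = Λ₀(f)` iff every `γ ∈ Γ₀(N)` has a period-zero partner `δ ∈ Γ₀(N)` with
`d_δ ≡ d_γ (mod N)`. -/
theorem periodLatticeGamma1_eq_periodLattice_iff :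
    periodLatticeGamma1 f = periodLattice f ↔
      ∀ γ : Gamma0 N, ∃ δ : Gamma0 N,
        (((δ : SL(2, ℤ)) 1 1 : ℤ) : ZMod N) = (((γ : SL(2, ℤ)) 1 1 : ℤ) : ZMod N) ∧ cuspSymbol f δ = 0 := by
  constructor
  · intro h γ
    exact (cuspSymbol_mem_periodLatticeGamma1_iff_exists_zero_period f γ).mp (h ▸ cuspSymbol_mem_periodLattice f γ)
  · intro h
    refine le_antisymm (periodLatticeGamma1_le_periodLattice f) ?_
    rw [periodLattice, AddSubgroup.closure_le]
    rintro _ ⟨γ, rfl⟩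
    exact (cuspSymbol_mem_periodLatticeGamma1_iff_exists_zero_period f γ).mpr (h γ)

/-- **53.A (iv) — residue form.**  `Λ₁(f) = Λ₀(f)` iff every integer `d` coprime to `N` is the lower-right
entry mod `N` of some `δ ∈ Γ₀(N)` with `{∞, δ∞}_f = 0` («every unit residue is a period-zero residue»);
uses the tree's Bézout lemma `exists_gamma0_apply_one_one_eq_int`. -/
theorem periodLatticeGamma1_eq_periodLattice_iff_residues :
    periodLatticeGamma1 f = periodLattice f ↔
      ∀ d : ℤ, IsCoprime d N → ∃ δ : Gamma0 N,
        (((δ : SL(2, ℤ)) 1 1 : ℤ) : ZMod N) = ((d : ℤ) : ZMod N) ∧ cuspSymbol f δ = 0 := by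
  rw [periodLatticeGamma1_eq_periodLattice_iff]
  constructor
  · intro h d hd
    obtain ⟨γ, hγ⟩ :=
      Summit.BirchSwinnertonDyer.BirchSwinnertonDyer.Theorems.ManinLocalTwoThree.exists_gamma0_apply_one_one_eq_int
        (N := N) hd
    obtain ⟨δ, hδ, h0⟩ := h γ
    exact ⟨δ, by rw [hδ, hγ], h0⟩
  · intro h γ
    have hcop : IsCoprime ((γ : SL(2, ℤ)) 1 1) (N : ℤ) := by
      have hdet := Matrix.det_fin_two (γ : SL(2, ℤ)).1
      rw [(γ : SL(2, ℤ)).2] at hdet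
      have hc : ((((γ : SL(2, ℤ)) 1 0 : ℤ)) : ZMod N) = 0 := Gamma0_mem.mp γ.2
      obtain ⟨k, hk⟩ := (ZMod.intCast_zmod_eq_zero_iff_dvd _ N).mp hc
      refine ⟨(γ : SL(2, ℤ)) 0 0, -((γ : SL(2, ℤ)) 0 1 * k), ?_⟩
      linear_combination (-1 : ℤ) * hdet + ((γ : SL(2, ℤ)) 0 1) * hk
    obtain ⟨δ, hδ, h0⟩ := h _ hcop
    exact ⟨δ, hδ, h0⟩

end Summit.BirchSwinnertonDyer.BirchSwinnertonDyer.Theorems.ManinLocalTwoThree.ShimuraLambdaOneImage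

#harness_tags Summit.BirchSwinnertonDyer.BirchSwinnertonDyer.Theorems.ManinLocalTwoThree.ShimuraLambdaOneImage.periodLatticeGamma1_eq_periodLattice_iff_residues
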